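import Summits.QuantumFields.YangMills.Theorems.BalabanUVNodesN27AtReadingOfRecord13CoPR
import Summits.QuantumFields.YangMills.Theorems.BalabanUVNodesN18AdmTransportPlaqSmall
import Summits.QuantumFields.YangMills.Theorems.BalabanUVNodesN18AtRateRecord13CoPR
import Summits.QuantumFields.YangMills.Theorems.BalabanUVNodesN22AtGeneratedHistory13CoPR


/-!
# BalabanUVNodes ∕ N27 = binder B5 AT THE RECORD, XLIIᶜᵒᴾᴿ — N27 AT THE ε-SMALL FIELDS ON THE GENERATED HISTORY, CoPR-KEYED STAGE 13: XLᶜᵒᴾᴿ's junctions at the admissible reading whose towers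
# are W1's generated run towers, whose tables are dag-n18-d's plaquette-small tables at `θ.toStage12Params` (Stage-12-keyed thresholds, unchanged), whose transport is the transport of record
# (`admTransport_plaqSmall_sharp`); N18 by dag-n18-d's Co twin of module 18, N22 by dag-n22-e 8c″ᶜᵒᴾᴿ `…N22AtGeneratedHistory13CoPR` (schemas currency): THE v1.6 `CoPR` EDITION OF MODULE XLII
# `…N27AtEpsSmallFieldsGen13` (p500920 ‴ ∕ p512897 ⁗); regime-generic
# (cell `pub-ymgap`, HUMAN RULING D-0062 Track A, R134 seat `pub-ymgap-dag-n27-c` (s2) gen 8; `--kind proof --supports <K3 id of record> --as helper`; COUNT-NEUTRAL; `N`-generic, NO Theses import)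

WHY THIS EDITION (v1.6 `CoPR` = RECORD 13 WITH THE RUN-INDEXED RESIDUAL 𝐓-WEIGHT SLOT `Zr` — director-ym №169 H1 ∕ №174 PRESS WORD ∕ №176, FINDING №8; def-T FILE 25 `Node00/Record13CoPR.lean`
p529474 ✓ + 26T `Node00/Record13SepCoPR.lean` p529780 ✓ (KEY-RULE-25), RR-2 `Node00/Record13DatumKeyCoPR.lean` p531309 ✓ ∕ `…KeySepCoPR`; route rev 22∕23, dag-lead WORDS-142: K3⁶
`SpineGivenEndpointR13SepCoPR` = stmt-QuantumFields-20509, the ⁵ items aside): this file is the T₆ image of my v1.5 storey `…N27AtEpsSmallFieldsGen13CoP (XLIIᶜᵒᴾ)` (p530577 ✓), which STANDS as a landed sibling —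
binder `θ : Node00.Stage13Params F N ↦ θ : Node00.Stage13RParams F N` (`extends Stage13Params` by the ONE field `Zr : (p : B12.RunParams) → TkResidualW Fam N (FluctV N) p.K`), core provisos
`θ.Provisos₁₃Core ↦ θ.Provisos₁₃CoPR` (v1.2's rows at `θ.toStage13Params` + `zrLaws ∕ zrLocal`), datum ∕ tower ∕ record ∕ shadow ∕ faces `…₁₃CoP ↦ …₁₃CoPR` (`datumOfRecord₁₃CoPR θ h` reads the
run's 𝐓-weights `WtOfRecord₁₃R θ p := tkWeightsOfRecordP … (gOfRecord₁₃ F N θ.toStage13Params p) (θ.Zr p)`), guard `θ.ZtUnity ↦ θ.ZrUnity` (RR-2 `unityNondeg₁₃ ↦ unityNondeg₁₃R`), RR-2's ∕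
the carriers' ∕ my stems `CoP ↦ CoPR`; θ-level objects NOT re-issued are cited at `θ.toStage13Params` (SITE-RULE; `θ.γ`, `θ.τ9`, `θ.Admissible`, `θ.SlotsNondegenerate₁₃`, `θ.toStage12Params`
through `extends`).  bg-BLIND and proviso-FIELD-blind as before: the provisos enter ONLY as the binder type `hc : θ.Provisos₁₃CoPR F N` and inside `datumOfRecord₁₃CoPR F N θ hc` (keyed ONCE; the
item edition's tuple `(θ, h : θ.Provisos₁₃SepCoPR F N)` applies it at `hc := h.toCore`, datum `rfl` by def-T's `datumOfRecord₁₃SepCoPR_eq_coPR`).  Statements AND proofs = the v1.5 module's,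
token for token under T₆; NO bridge to ∕ from the v1.5 storeys is stated (different data: `Zr p` per run vs `Zt p.K` per length; the ONE-WAY door ⁵ → ⁶ is def-T's `Stage13RParams.ofRunBlind`).

THE READING.  `readingOfRecord₁₃CoPR (fun F θ ↦ ReadingData.ofRecordAdm F θ.τ9.M N (runTowers fun k ↦ toClusterTower (G F θ k)) (fun k j _ ↦ (ι·, 0) '' {V | PlaqSmall (a F θ.toStage12Params k) V})
(gauge F θ) (hg F θ) (fun k ↦ transportRaw F k (avOfRecord F N (k+1) 0)) (admTransport_plaqSmall_sharp a ha hstep hguard F θ.toStage12Params) (li F θ)) ℓ₃ ne2 ne1` — generator `G`, gauges,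
letters `li`, `ne2`, `ne1` read off the Stage-13 tuple; thresholds through the parent tuple.

FIELD-BY-FIELD (differences to XLIᶜᵒᴾᴿ only).
* N18 — §1: dag-n18-d module 18 `s_N18_rRec₁₃CoPR_readingAdm_of_envelope_bound238_pin` at `hpin := readingOfRecord₁₃CoPR_u3 …`, its hypothesis VERBATIM at these towers ∕ tables ∕ transport:
  THE END's data (i) over the carriers of the admissible level pairing of the plaquette-small tables (step models `Mb b`, `locE` read-out action, L01–L03 ∕ L07–L09* on the window,
  numerals) and (ii) `SpRestr` ∕ `AnalyticH` ∕ the (2.38) envelope `Bound238` of the GENERATED towers at every step ON THE PLAQUETTE-SMALL TABLES, both runs, letters dominating;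
  §2: closed form at θ for the generated towers' (2.13) terms with the transport of record, over gauge fields with `PlaqSmall (a F θ.toStage12Params (k+1)) U` (`mem_image_ofBackgroundC_iff`).
* N22 — ELIMINATED given N18 in the SCHEMA currency (8b″): per admissible tuple (in the regime at §2) and run length `k`, `∃ Dk Adm` — `Dk` open, conjugation-symmetric, ⊇ the closed
  `li.r`-discs about `]0, θ.γ]`; admissible older-term classes along `recTerm (G F θ k)`; (A-last)ₘ ∕ (A-prop)ₘ for the steps `m < k` on the plaquette-small table; the complex sup letter
  `‖recTerm (G F θ k) (g[i ↦ z]) j X φ‖ ≤ li.A·li.μ^{j−1−i}·e^{−li.κ d_j(X)}` for `z ∈ Dk`, `i < j ≤ k`, `φ` a reading of an ε-small field — plus eleven numerals.  NO junk pin, NO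
  coherence clause, NO readings clause.
* N14, N15, N16, N17 (eliminated), (D4), spine side — as XLᶜᵒᴾᴿ ∕ XLI.

WHAT THIS MODULE PROVES ([bookkeeping]; each theorem ONE application of XLᶜᵒᴾᴿ `spine_rec13CCoPR(On)_at_readingOfRecord₁₃CoPR` with the producers' theorems in the slots).
* §1 `spine_rec13CCoPR_at_epsSmallFieldsGen₁₃CoPR_of_envelope_bound238` — canonical home ⇒ `Spine ₁₃CCoPR`.
* §2 `spine_rec13CCoPROn_at_epsSmallFieldsGen₁₃CoPR` — regime home, any `Rg` ⇒ `Spine` at `IsRecordOfRecord₁₃CCoPROn F N Rg`; at `Rg := Node00.unityNondeg₁₃R 2` = THE ITEM (XXXVII-class leaf §4).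

HONEST FRAMING.  COUNT-NEUTRAL kernel bookkeeping BY NAME at a COMPOSITE node; every node estimate is a DISPLAYED hypothesis or a producer's displayed hypothesis carried
verbatim; the generator `G` is DATA (INHABITATION IS NOT CONTENT — dag-n22-e `genSchemas_nonvacuous`; a discharge names Bałaban's (2.14)–(2.26) generator), positive thresholds make
the tables inhabited; whether Bałaban's generated terms satisfy the schemas ∕ `AnalyticH` ∕ `Bound238` on the ε-small tables is asserted NOWHERE here; no inhabitant of any record
class is claimed (K0 of the edition, open); nothing of Bałaban's asserted or instantiated; NE1′–NE9 ∕ NE7 ∕ NE7b ∕ NE7c are NOT PRINTED for d = 4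
and NOT PROVED; N27 NOT discharged, K3 NOT claimed; counts UNMOVED (typed 28∕28 · discharged 5∕27, A 5∕28); one finite four-torus programme at fixed `ε` — NOT ℝ⁴, NOT
infinite volume, NOT OS, NOT a mass gap, NOT Clay.  General-`N` throughout.  No decl below carries a cite tag.
-/

noncomputable section

open Set Metric ComplexConjugate
open scoped Matrix.Norms.L2Operator

namespace Summit.QuantumFields.YangMills.Theorems.BalabanUVNodesN27SpineRecord

open Literature.MathematicalPhysics.QuantumFieldTheory.Balaban1983to89
open Literature.MathematicalPhysics.QuantumFieldTheory.Balaban1983to89.T4Continuum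
open Literature.MathematicalPhysics.QuantumFieldTheory.Balaban1983to89.T4OutputRate (Carriers Functional NE5 DecayBound Window)
open Literature.MathematicalPhysics.QuantumFieldTheory.Balaban1983to89.T4InputCauchyRateData (StepModel)
open Literature.MathematicalPhysics.QuantumFieldTheory.Balaban1983to89.B13Resummation (locE)
open Literature.MathematicalPhysics.QuantumFieldTheory.Balaban1983to89.TreeLengthTorus (TDom tsys torusTreeLen)
open Literature.MathematicalPhysics.QuantumFieldTheory.Balaban1983to89.TreeLengthTorusGeometry (TTouch)
open Literature.MathematicalPhysics.QuantumFieldTheory.Balaban1983to89.B12TreeDecay (K₀)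
open Literature.MathematicalPhysics.QuantumFieldTheory.Balaban1983to89.ExpMeanLog (deltaSU)
open T4ContinuumYM4Torus (ForSmallCouplings)
open Summit.QuantumFields.BalabanUV.T4Continuum.Spine
open Summit.QuantumFields.BalabanUV.T4Continuum.Spine.NE5
open Summit.QuantumFields.BalabanUV.T4Continuum.B13Carriers (transportRaw)
open YMDAG.UVSplit
open YMDAG.N18.HLayer
open YMDAG.N18.W1Reading (s_N18_rRec₁₃CoPR_readingAdm_of_envelope_bound238_pin admTransport_plaqSmall_sharp n18At_u3OfRecord₁₃_readingAdm_iff mem_image_ofBackgroundC_iff)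
open YMDAG.N22 (s_N22_readingOfRecord₁₃CoPR_gen_of_s_N18_schemasBelow s_N22_readingOfRecord₁₃CoPROn_gen_of_s_N18_schemasBelow)
open Node00 (Stage12Params Stage13RParams datumOfRecord₁₃CoPR IsRecordOfRecord₁₃CCoPR IsDatumOfRecord₁₃CCoPR NE3Letters₁₁ NE2Objects₁₁ ne3ConstLayerOfRecord₁₁ MatA ιSU prependCoupling avOfRecord)
open Node00.Sect2 (domCount domSys CPair ofBackgroundC cubeDom)
open Node00.W1
open Summit.QuantumFields.YangMills.BalabanUVNodes.N16Regime (InEndRegime)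
open Summit.QuantumFields.YangMills.BalabanUVNodes.N16LeafSlot (LeafSlot)
open Summit.QuantumFields.YangMills.BalabanUVNodes.N16AtRRec13CoPR (s_N16_rRec₁₃CoPR_of_constLayer_leafSlot s_N16_rRec₁₃CoPROn_ofRecord_of_leafSlot)

variable {N : ℕ} [NeZero N] (cr : SpineReading₁₃CoPR N)
  (G : (F : T4Family) → (θ : Stage13RParams F N) → (k : ℕ) → GenTower (F.P k) (MatA N) θ.τ9.M)
  (a : (F : T4Family) → Stage12Params F N → ℕ → ℝ)
  (ha : ∀ (F : T4Family) (θ : Stage12Params F N) (k : ℕ), 0 < a F θ (k + 1))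
  (hstep : ∀ (F : T4Family) (θ : Stage12Params F N) (k : ℕ),
    ((F.P (k + 1)).L : ℝ) ^ 2 * a F θ (k + 1) + 143 * (((((F.P (k + 1)).d + 4) * (F.P (k + 1)).L : ℕ) : ℝ) ^ 2 / 4 * a F θ (k + 1)) ^ 2 ≤ a F θ k)
  (hguard : ∀ (F : T4Family) (θ : Stage12Params F N) (k : ℕ),
    ((((F.P (k + 1)).d + 4) * (F.P (k + 1)).L : ℕ) : ℝ) ^ 2 / 4 * a F θ (k + 1) ≤ deltaSU (Fin N) / 2)
  (gauge : (F : T4Family) → (θ : Stage13RParams F N) → (k : ℕ) → GaugeField (F.P k) 0 (Node00.SU N) → GaugeField (F.P k) 0 (Node00.SU N) → ℝ)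
  (hg : ∀ (F : T4Family) (θ : Stage13RParams F N) (k : ℕ) (U U' : GaugeField (F.P k) 0 (Node00.SU N)), 0 ≤ gauge F θ k U U')
  (li : (F : T4Family) → Stage13RParams F N → LetterInputs) (ℓ₃ : T4Family → NE3Letters₁₁)
  (ne2 : (F : T4Family) → Stage13RParams F N → (ℕ → ℝ) → List (ULoop F) → ℕ → NE2Objects₁₁)
  (ne1 : (F : T4Family) → Stage13RParams F N → (ℕ → ℝ) → List (ULoop F) → NE1pCarriers)


/-! ## §1 The canonical home at the ε-small fields on the generated history -/

section Canonical

open Classical in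
/-- **N27 = B5 AT THE STAGE-12 RECORD FROM THE SLOTS AT THE CANONICAL HOME OF THE ADMISSIBLE READING ON THE GENERATED HISTORY AT THE ε-SMALL FIELDS — N17 ∕ N22
ELIMINATED, N18 FROM THE END's DATA, NO JUNK ∕ COHERENCE ∕ READINGS ∕ TRANSPORT CLAUSE** (XLᶜᵒᴾᴿ `spine_rec13CCoPR_at_readingOfRecord₁₃CoPR` at the reading of the header).  Rate side:
NE1′ ∕ NE2 at `h.params` (displayed); NE3 as `InEndRegime ∧ LeafSlot` once per family (dag-n16-e); N18 ⟸ dag-n18-d module 18 `s_N18_rRec₁₃CoPR_readingAdm_of_envelope_bound238_pin` at the generated towers ∕ plaquette-small tables ∕ transport of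
record — THE END's data over the admissible plaquette-small carriers (step models, `locE` action, L01–L03, L07–L09*, numerals) and `SpRestr` ∕ `AnalyticH` ∕ `Bound238` of
`runTowers (k ↦ toClusterTower (G F θ k)) k ∕ (k+1)` at every step ON THE PLAQUETTE-SMALL TABLES, letters dominating — VERBATIM; N22 ⟸ N18 by dag-n22-e 8b″
`s_N22_readingOfRecord₁₃CoPR_gen_of_s_N18_schemasBelow` — W1's per-step schemas for the generator `G F θ k` on the plaquette-small table + the complex sup-letter inequality schema on
`recTerm (G F θ k)` at the readings of the ε-small fields + eleven numerals — VERBATIM (the SAME `h18` feeds it); (D4) displayed; spine side as XXXVIII.  Side conditions on the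
thresholds: `ha`, `hstep`, `hguard`. [bookkeeping] -/
theorem spine_rec13CCoPR_at_epsSmallFieldsGen₁₃CoPR_of_envelope_bound238
    (h14 : ∀ (F : T4Family) (D : Datum F N) (h : IsDatumOfRecord₁₃CCoPR F N D) (g₀ : ℕ → ℝ) (os : List (ULoop F)), N14At (ne1 F h.params g₀ os))
    (h15 : ∀ (F : T4Family) (D : Datum F N) (h : IsDatumOfRecord₁₃CCoPR F N D) (g₀ : ℕ → ℝ) (os : List (ULoop F)) (k : ℕ),
      N15At (ne2OfRecord₁₁ (ne2 F h.params g₀ os k)))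
    (h16 : ∀ (F : T4Family), (∃ D : Datum F N, IsDatumOfRecord₁₃CCoPR F N D) →
      InEndRegime (ne3OfRecord₁₁ F (ne3ConstLayerOfRecord₁₁ F N (ℓ₃ F))) ∧ LeafSlot (ne3OfRecord₁₁ F (ne3ConstLayerOfRecord₁₁ F N (ℓ₃ F))))
    -- N18 ⟸ THE END's data and the GENERATED towers' H-layer data ON THE PLAQUETTE-SMALL TABLES (dag-n18-d module 18's generic pin face at these towers ∕ tables ∕ transport, verbatim)
    (h18 : ∀ (F : T4Family) (θ : Stage13RParams F N), θ.Provisos₁₃CoPR F N → θ.Admissible F N → ∀ k : ℕ,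
      ∃ (Op : Type) (_ : NormedAddCommGroup Op) (_ : NormedSpace ℂ Op) (Hist : Type) (_ : NormedAddCommGroup Hist) (_ : NormedSpace ℂ Hist)
        (Mb : ℝ → StepModel (LevelPairing.ofRecordAdm F θ.τ9.M N k (fun (k j : ℕ) (_ : (domSys (F.P k) θ.τ9.M j).Dom) =>
            ofBackgroundC (ιSU N) '' {V : GaugeField (F.P k) 0 (Node00.SU N) | PlaqSmall (a F θ.toStage12Params k) V})
          (gauge F θ k) (hg F θ k) (transportRaw F k (avOfRecord F N (k + 1) 0)) (admTransport_plaqSmall_sharp a ha hstep hguard F θ.toStage12Params k)).carriers Op Hist)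
        (act : ℝ → (j : ℕ) → Op × Hist → TDom 4 (domCount (F.P k) θ.τ9.M j) → ℂ) (γ' C3 ε₁ Rd κ A_A A_B E₁ δ δ' θr θ' cH ω ρ₀ B : ℝ) (k₀ : ℕ),
        -- (i) the END's data over the carriers of the admissible level pairing
        (∀ b : ℝ, 0 < b → b ≤ γ' → ∀ (X : Node00.W1.Dom (F.P k) θ.τ9.M) (z : Op × Hist),
          (Mb b).Out X.1 z.1 z.2 X =
            locE (TTouch (d := 4) (N := domCount (F.P k) θ.τ9.M X.1)) (fun Z : (tsys 4 (domCount (F.P k) θ.τ9.M X.1)).Dom => Z.1)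
              (act b X.1 z) X.2.1) ∧
        0 ≤ C3 ∧ 0 ≤ ε₁ ∧ 0 ≤ κ ∧ κ + 2 * (64 * Real.log 162) + 2 ≤ Rd ∧
        C3 * ε₁ * Real.exp (5 * κ + 1) * K₀ 64 8 * 9 * 64 ≤ 1 ∧
        (∀ b : ℝ, 0 < b → b ≤ γ' → ∀ j, ∀ g ∈ Window γ',
          ∀ (U : (LevelPairing.ofRecordAdm F θ.τ9.M N k (fun (k j : ℕ) (_ : (domSys (F.P k) θ.τ9.M j).Dom) =>
            ofBackgroundC (ιSU N) '' {V : GaugeField (F.P k) 0 (Node00.SU N) | PlaqSmall (a F θ.toStage12Params k) V})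
          (gauge F θ k) (hg F θ k) (transportRaw F k (avOfRecord F N (k + 1) 0)) (admTransport_plaqSmall_sharp a ha hstep hguard F θ.toStage12Params k)).BgB) (q : Op × Hist),
          q ∈ (Mb b).Base j g U →
          ∃ V : Set (Op × Hist), IsOpen V ∧ (Mb b).box j q ⊆ V ∧
            (∀ Z : TDom 4 (domCount (F.P k) θ.τ9.M j), DifferentiableOn ℂ (fun z : Op × Hist => act b j z Z) V) ∧
            (∀ z ∈ V, ∀ Z : TDom 4 (domCount (F.P k) θ.τ9.M j), ‖act b j z Z‖ ≤ C3 * ε₁ * Real.exp (-(Rd * torusTreeLen Z.1)))) ∧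
        (∀ b : ℝ, 0 < b → b ≤ γ' → L01 (Mb b)
          ((LevelPairing.ofRecordAdm F θ.τ9.M N k (fun (k j : ℕ) (_ : (domSys (F.P k) θ.τ9.M j).Dom) =>
            ofBackgroundC (ιSU N) '' {V : GaugeField (F.P k) 0 (Node00.SU N) | PlaqSmall (a F θ.toStage12Params k) V})
          (gauge F θ k) (hg F θ k) (transportRaw F k (avOfRecord F N (k + 1) 0)) (admTransport_plaqSmall_sharp a ha hstep hguard F θ.toStage12Params k)).EA (runTowers (fun k => toClusterTower (G F θ k)) k)) (Window γ')) ∧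
        (∀ b : ℝ, 0 < b → b ≤ γ' → L02 (Mb b)
          ((LevelPairing.ofRecordAdm F θ.τ9.M N k (fun (k j : ℕ) (_ : (domSys (F.P k) θ.τ9.M j).Dom) =>
            ofBackgroundC (ιSU N) '' {V : GaugeField (F.P k) 0 (Node00.SU N) | PlaqSmall (a F θ.toStage12Params k) V})
          (gauge F θ k) (hg F θ k) (transportRaw F k (avOfRecord F N (k + 1) 0)) (admTransport_plaqSmall_sharp a ha hstep hguard F θ.toStage12Params k)).EB (runTowers (fun k => toClusterTower (G F θ k)) (k + 1)) b)
          (Window γ')) ∧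
        (∀ b : ℝ, 0 < b → b ≤ γ' → L03 (Mb b)
          ((LevelPairing.ofRecordAdm F θ.τ9.M N k (fun (k j : ℕ) (_ : (domSys (F.P k) θ.τ9.M j).Dom) =>
            ofBackgroundC (ιSU N) '' {V : GaugeField (F.P k) 0 (Node00.SU N) | PlaqSmall (a F θ.toStage12Params k) V})
          (gauge F θ k) (hg F θ k) (transportRaw F k (avOfRecord F N (k + 1) 0)) (admTransport_plaqSmall_sharp a ha hstep hguard F θ.toStage12Params k)).EB (runTowers (fun k => toClusterTower (G F θ k)) (k + 1)) b)
          (Window γ')) ∧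
        (∀ b : ℝ, 0 < b → b ≤ γ' → L07 (Mb b) (Window γ') δ θr) ∧
        (∀ b : ℝ, 0 < b → b ≤ γ' → L08 (Mb b) (Window γ') κ (Real.exp 1 * 9 * 64 * K₀ 64 8 ^ 2 * A_B) δ' θr) ∧
        (∀ b : ℝ, 0 < b → b ≤ γ' → L09aff (Mb b) (Window γ')) ∧ (∀ b : ℝ, 0 < b → b ≤ γ' → L09blind (Mb b) (Window γ')) ∧
        (∀ b : ℝ, 0 < b → b ≤ γ' → L09hom (Mb b) (Window γ')) ∧ (∀ b : ℝ, 0 < b → b ≤ γ' → L09unit (Mb b) (Window γ') κ E₁ cH ω) ∧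
        0 < E₁ ∧ 0 ≤ δ + δ' ∧ 0 ≤ θr ∧ θr ≤ θ' ∧ θ' ≤ 1 ∧ 0 ≤ cH ∧ 0 < ω ∧ ρ₀ < 1 ∧
        (δ + δ') * θr ^ k₀ +
            cH * (Real.exp 1 * 9 * 64 * K₀ 64 8 ^ 2 * A_A + Real.exp 1 * 9 * 64 * K₀ 64 8 ^ 2 * A_B) / (1 - ω) ≤ ρ₀ ∧
        0 ≤ B ∧ (∀ k < k₀, Real.exp 1 * 9 * 64 * K₀ 64 8 ^ 2 * A_A + Real.exp 1 * 9 * 64 * K₀ 64 8 ^ 2 * A_B ≤ B * θr ^ k) ∧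
        Real.exp 1 * 9 * 64 * K₀ 64 8 ^ 2 * C3 * cH * ε₁ < (θ' - ω) * (1 - ρ₀) ∧
        -- (ii) the towers' H-layer data in the configuration direction ON THE TABLES, both runs
        (∀ m, SpRestr (fun _ : (domSys (F.P k) θ.τ9.M (m + 1)).Dom => ofBackgroundC (ιSU N) '' {V : GaugeField (F.P k) 0 (Node00.SU N) | PlaqSmall (a F θ.toStage12Params k) V})) ∧
        (∀ m, (runTowers (fun k => toClusterTower (G F θ k)) k m).AnalyticH (box γ' m) (fun _ : (domSys (F.P k) θ.τ9.M (m + 1)).Dom => ofBackgroundC (ιSU N) '' {V : GaugeField (F.P k) 0 (Node00.SU N) | PlaqSmall (a F θ.toStage12Params k) V})) ∧ (∀ m, (runTowers (fun k => toClusterTower (G F θ k)) k m).Bound238 (box γ' m) (fun _ : (domSys (F.P k) θ.τ9.M (m + 1)).Dom => ofBackgroundC (ιSU N) '' {V : GaugeField (F.P k) 0 (Node00.SU N) | PlaqSmall (a F θ.toStage12Params k) V}) A_A Rd) ∧ 0 ≤ A_A ∧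
        A_A * Real.exp (5 * κ + 1) * K₀ 64 8 * 9 * 64 < 1 ∧
        (∀ m, SpRestr (fun _ : (domSys (F.P (k + 1)) θ.τ9.M (m + 1)).Dom => ofBackgroundC (ιSU N) '' {V : GaugeField (F.P (k + 1)) 0 (Node00.SU N) | PlaqSmall (a F θ.toStage12Params (k + 1)) V})) ∧
        (∀ m, (runTowers (fun k => toClusterTower (G F θ k)) (k + 1) m).AnalyticH (box γ' m) (fun _ : (domSys (F.P (k + 1)) θ.τ9.M (m + 1)).Dom => ofBackgroundC (ιSU N) '' {V : GaugeField (F.P (k + 1)) 0 (Node00.SU N) | PlaqSmall (a F θ.toStage12Params (k + 1)) V})) ∧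
        (∀ m, (runTowers (fun k => toClusterTower (G F θ k)) (k + 1) m).Bound238 (box γ' m) (fun _ : (domSys (F.P (k + 1)) θ.τ9.M (m + 1)).Dom => ofBackgroundC (ιSU N) '' {V : GaugeField (F.P (k + 1)) 0 (Node00.SU N) | PlaqSmall (a F θ.toStage12Params (k + 1)) V}) A_B Rd) ∧
        0 ≤ A_B ∧ A_B * Real.exp (5 * κ + 1) * K₀ 64 8 * 9 * 64 < 1 ∧
        -- the reading's letters dominate the END's
        θ.γ ≤ γ' ∧ (li F θ).κ ≤ κ ∧ θ' ≤ (li F θ).θ₅ ∧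
        (Real.exp 1 * 9 * 64 * K₀ 64 8 ^ 2 * (C3 * ε₁) / (1 - ρ₀) * (δ + δ') + B) * (θ' - ω) /
            (θ' - (ω + Real.exp 1 * 9 * 64 * K₀ 64 8 ^ 2 * (C3 * ε₁) / (1 - ρ₀) * cH)) ≤ (li F θ).C₅)
    -- N22 ⟸ N18 ON THE GENERATED TOWERS (dag-n22-e module 8b″): W1's per-step SCHEMAS for the generator `G F θ k` on the plaquette-small table + ONE inequality schema
    -- (the complex sup letter for the generated terms at the readings of the ε-small fields) + eleven numerals — verbatim; NO junk pin, NO coherence, NO readings clause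
    (hsch : ∀ (F : T4Family) (θ : Stage13RParams F N), θ.Provisos₁₃CoPR F N → θ.Admissible F N → ∀ (k : ℕ),
      ∃ (Dk : Set ℂ) (Adm : (m : ℕ) → Set (OlderTerms (F.P k) (MatA N) θ.τ9.M m)),
        IsOpen Dk ∧ (∀ z ∈ Dk, conj z ∈ Dk) ∧ (∀ t ∈ Ioc (0 : ℝ) θ.γ, closedBall (t : ℂ) (li F θ).r ⊆ Dk) ∧
        (∀ g : ℕ → ℂ, (∀ n, g n ∈ Dk) → ∀ m < k, olderOf (recTerm (G F θ k) g) m ∈ Adm m) ∧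
        (∀ m < k, (G F θ k m).AnalyticInLast Dk (Adm m) (fun _ : (domSys (F.P k) θ.τ9.M (m + 1)).Dom => ofBackgroundC (ιSU N) '' {V : GaugeField (F.P k) 0 (Node00.SU N) | PlaqSmall (a F θ.toStage12Params k) V})) ∧
        (∀ m < k, (G F θ k m).PropagatesAnalyticity Dk (Adm m) (fun (j : Fin (m + 1)) (_ : (domSys (F.P k) θ.τ9.M j).Dom) => ofBackgroundC (ιSU N) '' {V : GaugeField (F.P k) 0 (Node00.SU N) | PlaqSmall (a F θ.toStage12Params k) V}) (fun _ : (domSys (F.P k) θ.τ9.M (m + 1)).Dom => ofBackgroundC (ιSU N) '' {V : GaugeField (F.P k) 0 (Node00.SU N) | PlaqSmall (a F θ.toStage12Params k) V})) ∧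
        (∀ g ∈ Window θ.γ, ∀ (i j : ℕ), i < j → j ≤ k → ∀ (X : (domSys (F.P k) θ.τ9.M j).Dom), ∀ φ ∈ ofBackgroundC (ιSU N) '' {V : GaugeField (F.P k) 0 (Node00.SU N) | PlaqSmall (a F θ.toStage12Params k) V}, ∀ z ∈ Dk,
          ‖recTerm (G F θ k) (Function.update (fun n => ((g n : ℝ) : ℂ)) i z) j X φ‖ ≤
            (li F θ).A * (li F θ).μ ^ (j - 1 - i) * Real.exp (-((li F θ).κ * (domSys (F.P k) θ.τ9.M j).dj X))))
    (hnum : ∀ (F : T4Family) (θ : Stage13RParams F N), θ.Provisos₁₃CoPR F N → θ.Admissible F N →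
      0 < (li F θ).C₀ ∧ 0 < (li F θ).θ₅ ∧ (li F θ).θ₅ < 1 ∧ 0 ≤ (li F θ).C₅ ∧ 2 * (li F θ).C₅ / (1 - (li F θ).θ₅) ≤ (li F θ).C₀ ∧ 0 < (li F θ).A ∧
        (li F θ).θ₅ ≤ (li F θ).μ ∧ (li F θ).C₀ ≤ 2 * (li F θ).A ∧ 0 < (li F θ).r ∧ 0 < (li F θ).s ∧ (li F θ).s < 1)
    (hD4 : ∀ (F : T4Family) (D : Datum F N) (h : IsDatumOfRecord₁₃CCoPR F N D) (k : ℕ), ReadOutAt D (u3OfRecord₁₃ h.params.toStage13Params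
      ((ReadingData.ofRecordAdm F h.params.τ9.M N (runTowers fun k => toClusterTower (G F h.params k))
          (fun (k j : ℕ) (_ : (domSys (F.P k) h.params.τ9.M j).Dom) => ofBackgroundC (ιSU N) '' {V : GaugeField (F.P k) 0 (Node00.SU N) | PlaqSmall (a F h.params.toStage12Params k) V})
          (gauge F h.params) (hg F h.params) (fun k => transportRaw F k (avOfRecord F N (k + 1) 0)) (admTransport_plaqSmall_sharp a ha hstep hguard F h.params.toStage12Params) (li F h.params)).u3Objects h.params.γ) k))
    (hx' : S_N27x (fun F D w => IsRecordOfRecord₁₃CCoPR F N D w) (SRec₁₃CoPR cr)) (h20 : S_N20 (SRec₁₃CoPR cr)) (h21 : S_N21 (SRec₁₃CoPR cr))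
    (h19 : ∀ (F : T4Family) (θ : Stage13RParams F N) (hP : θ.Provisos₁₃CoPR F N), θ.Admissible F N → ∀ (g₀ : ℕ → ℝ) (os : List (ULoop F))
      (h : IsDatumOfRecord₁₃CCoPR F N (datumOfRecord₁₃CoPR F N θ hP)) (k : ℕ),
      RatesAt (datumOfRecord₁₃CoPR F N θ hP) (rateCarriersOfRecord₁₃CoPR (readingOfRecord₁₃CoPR
        (fun F θ => ReadingData.ofRecordAdm F θ.τ9.M N (runTowers fun k => toClusterTower (G F θ k))
          (fun (k j : ℕ) (_ : (domSys (F.P k) θ.τ9.M j).Dom) => ofBackgroundC (ιSU N) '' {V : GaugeField (F.P k) 0 (Node00.SU N) | PlaqSmall (a F θ.toStage12Params k) V})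
          (gauge F θ) (hg F θ) (fun k => transportRaw F k (avOfRecord F N (k + 1) 0)) (admTransport_plaqSmall_sharp a ha hstep hguard F θ.toStage12Params) (li F θ)) ℓ₃ ne2 ne1)
          F h.params h.provisos g₀ os k) → letI := (cr F θ hP g₀ os).dec
        ∃ δ : ℕ → ℝ, NE7.Core (cr F θ hP g₀ os).l₀ (cr F θ hP g₀ os).vol (cr F θ hP g₀ os).T (cr F θ hP g₀ os).Bad
          (fun K t τ => (cr F θ hP g₀ os).A K t τ - (cr F θ hP g₀ os).shA K t τ) (fun K t τ => (cr F θ hP g₀ os).B K t τ - (cr F θ hP g₀ os).shB K t τ) δ ∧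
          Summable δ) :
    Spine (N := N) fun F D w => IsRecordOfRecord₁₃CCoPR F N D w :=
  have h18' := s_N18_rRec₁₃CoPR_readingAdm_of_envelope_bound238_pin _ (fun F θ => runTowers fun k => toClusterTower (G F θ k))
    (fun F θ (k j : ℕ) (_ : (domSys (F.P k) θ.τ9.M j).Dom) => ofBackgroundC (ιSU N) '' {V : GaugeField (F.P k) 0 (Node00.SU N) | PlaqSmall (a F θ.toStage12Params k) V})
    gauge hg (fun F _ k => transportRaw F k (avOfRecord F N (k + 1) 0)) (fun F θ => admTransport_plaqSmall_sharp a ha hstep hguard F θ.toStage12Params) li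
    (readingOfRecord₁₃CoPR_u3 _ ℓ₃ ne2 ne1) h18
  spine_rec13CCoPR_at_readingOfRecord₁₃CoPR cr _ ℓ₃ ne2 ne1 ((s_N14_readingOfRecord₁₃CoPR_iff _ ℓ₃ ne2 ne1).mpr h14) ((s_N15_readingOfRecord₁₃CoPR_iff _ ℓ₃ ne2 ne1).mpr h15)
    (s_N16_rRec₁₃CoPR_of_constLayer_leafSlot (readingOfRecord₁₃CoPR _ ℓ₃ ne2 ne1) (fun F => ne3ConstLayerOfRecord₁₁ F N (ℓ₃ F)) (fun _ _ _ _ _ _ => rfl) h16) h18'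
    (s_N22_readingOfRecord₁₃CoPR_gen_of_s_N18_schemasBelow G
      (fun F θ (k j : ℕ) (_ : (domSys (F.P k) θ.τ9.M j).Dom) => ofBackgroundC (ιSU N) '' {V : GaugeField (F.P k) 0 (Node00.SU N) | PlaqSmall (a F θ.toStage12Params k) V})
      gauge hg (fun F _ k => transportRaw F k (avOfRecord F N (k + 1) 0)) (fun F θ => admTransport_plaqSmall_sharp a ha hstep hguard F θ.toStage12Params) li ne1 ℓ₃ ne2 h18' hsch hnum)
    ((s_D4_readingOfRecord₁₃CoPR_iff _ ℓ₃ ne2 ne1).mpr hD4) hx' h20 h21 h19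

end Canonical

/-! ## §2 The regime-restricted home at the ε-small fields on the generated history, any regime `Rg` -/

section Regime

variable (Rg : (F : T4Family) → Stage13RParams F N → Prop)

/-- **N27 = B5 AT THE REGIME RECORD CLASS `IsRecordOfRecord₁₃CCoPROn F N Rg` FROM THE SLOTS AT THE REGIME HOME OF THE ADMISSIBLE READING ON THE GENERATED HISTORY AT THE ε-SMALL
FIELDS, ANY `Rg` — N17 ∕ N22 ELIMINATED, N18 IN CLOSED FORM** (XLᶜᵒᴾᴿ `spine_rec13CCoPROn_at_readingOfRecord₁₃CoPR` at the reading of the header).  For every family and every Stage-13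
tuple `θ` with provisos IN THE REGIME, admissible: NE1′ ∕ NE2 at θ (displayed); NE3 once per guarded family; N18 DISPLAYED IN CLOSED FORM (dag-n18-d `n18At_readingAdm_iff` +
`mem_image_ofBackgroundC_iff`): for every run length `k`, member `b ∈ ]0, θ.γ]`, history `g ∈ ]0, θ.γ]^ℕ`, gauge field `U` of the `(k+1)`-th torus with `PlaqSmall (a F θ (k+1)) U`
and run-A domain `(j, X)`, `|Re E^{(j)}_{runTowers … k}(X; g; (ι(transportRaw F k (avOfRecord F N (k+1) 0) U), 0)) − Re E^{(j+1)}_{runTowers … (k+1)}(pairOfRecord (j, X); b∷g;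
(ιU, 0))| ≤ C₅·θ₅^j·e^{−κ d_j(X)}` with the letters `li F θ`; N22 ⟸ N18 by dag-n22-e 8b regime `s_N22_readingOfRecord₁₃CoPROn_gen_of_s_N18_schemas` (schemas + numerals VERBATIM,
asked in the regime; the SAME closed-form N18 feeds it); (D4) at θ displayed; spine side as XXXIX.  At `Rg := Node00.unityNondeg₁₃R N`, `N = 2` THE ITEM is XXXVII-class leaf §4
`spineGivenEndpointR13CoPR_of_spine_rec13CCoPROn` of this. [bookkeeping] -/
theorem spine_rec13CCoPROn_at_epsSmallFieldsGen₁₃CoPR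
    (h14 : ∀ (F : T4Family) (θ : Stage13RParams F N), θ.Provisos₁₃CoPR F N → Rg F θ → θ.Admissible F N → ∀ (g₀ : ℕ → ℝ) (os : List (ULoop F)),
      N14At (ne1 F θ g₀ os))
    (h15 : ∀ (F : T4Family) (θ : Stage13RParams F N), θ.Provisos₁₃CoPR F N → Rg F θ → θ.Admissible F N → ∀ (g₀ : ℕ → ℝ) (os : List (ULoop F)) (k : ℕ),
      N15At (ne2OfRecord₁₁ (ne2 F θ g₀ os k)))
    (h16 : ∀ (F : T4Family), (∃ θ : Stage13RParams F N, θ.Provisos₁₃CoPR F N ∧ Rg F θ ∧ θ.Admissible F N) →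
      InEndRegime (ne3OfRecord₁₁ F (ne3ConstLayerOfRecord₁₁ F N (ℓ₃ F))) ∧ LeafSlot (ne3OfRecord₁₁ F (ne3ConstLayerOfRecord₁₁ F N (ℓ₃ F))))
    -- N18 in closed form AT THE ε-SMALL FIELDS: the generated towers' (2.13) terms, transport of record
    (h18 : ∀ (F : T4Family) (θ : Stage13RParams F N), θ.Provisos₁₃CoPR F N → Rg F θ → θ.Admissible F N → ∀ (k : ℕ) (b : ℝ), 0 < b → b ≤ θ.γ →
      ∀ g ∈ Window θ.γ, ∀ (U : GaugeField (F.P (k + 1)) 0 (Node00.SU N)), PlaqSmall (a F θ.toStage12Params (k + 1)) U → ∀ (X : Node00.W1.Dom (F.P k) θ.τ9.M),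
        |(functionalC (runTowers (fun k => toClusterTower (G F θ k)) k) g (ofBackgroundC (ιSU N) (transportRaw F k (avOfRecord F N (k + 1) 0) U)) X).re -
            (functionalC (runTowers (fun k => toClusterTower (G F θ k)) (k + 1)) (prependCoupling b g) (ofBackgroundC (ιSU N) U)
              (pairOfRecord F θ.τ9.M k X)).re| ≤
          (li F θ).C₅ * (li F θ).θ₅ ^ X.1 * Real.exp (-((li F θ).κ * (domSys (F.P k) θ.τ9.M X.1).dj X.2)))
    -- N22 ⟸ N18 ON THE GENERATED TOWERS (dag-n22-e module 8b″): W1's per-step SCHEMAS for the generator `G F θ k` on the plaquette-small table + ONE inequality schema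
    -- (the complex sup letter for the generated terms at the readings of the ε-small fields) + eleven numerals — verbatim; NO junk pin, NO coherence, NO readings clause
    (hsch : ∀ (F : T4Family) (θ : Stage13RParams F N), θ.Provisos₁₃CoPR F N → Rg F θ → θ.Admissible F N → ∀ (k : ℕ),
      ∃ (Dk : Set ℂ) (Adm : (m : ℕ) → Set (OlderTerms (F.P k) (MatA N) θ.τ9.M m)),
        IsOpen Dk ∧ (∀ z ∈ Dk, conj z ∈ Dk) ∧ (∀ t ∈ Ioc (0 : ℝ) θ.γ, closedBall (t : ℂ) (li F θ).r ⊆ Dk) ∧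
        (∀ g : ℕ → ℂ, (∀ n, g n ∈ Dk) → ∀ m < k, olderOf (recTerm (G F θ k) g) m ∈ Adm m) ∧
        (∀ m < k, (G F θ k m).AnalyticInLast Dk (Adm m) (fun _ : (domSys (F.P k) θ.τ9.M (m + 1)).Dom => ofBackgroundC (ιSU N) '' {V : GaugeField (F.P k) 0 (Node00.SU N) | PlaqSmall (a F θ.toStage12Params k) V})) ∧
        (∀ m < k, (G F θ k m).PropagatesAnalyticity Dk (Adm m) (fun (j : Fin (m + 1)) (_ : (domSys (F.P k) θ.τ9.M j).Dom) => ofBackgroundC (ιSU N) '' {V : GaugeField (F.P k) 0 (Node00.SU N) | PlaqSmall (a F θ.toStage12Params k) V}) (fun _ : (domSys (F.P k) θ.τ9.M (m + 1)).Dom => ofBackgroundC (ιSU N) '' {V : GaugeField (F.P k) 0 (Node00.SU N) | PlaqSmall (a F θ.toStage12Params k) V})) ∧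
        (∀ g ∈ Window θ.γ, ∀ (i j : ℕ), i < j → j ≤ k → ∀ (X : (domSys (F.P k) θ.τ9.M j).Dom), ∀ φ ∈ ofBackgroundC (ιSU N) '' {V : GaugeField (F.P k) 0 (Node00.SU N) | PlaqSmall (a F θ.toStage12Params k) V}, ∀ z ∈ Dk,
          ‖recTerm (G F θ k) (Function.update (fun n => ((g n : ℝ) : ℂ)) i z) j X φ‖ ≤
            (li F θ).A * (li F θ).μ ^ (j - 1 - i) * Real.exp (-((li F θ).κ * (domSys (F.P k) θ.τ9.M j).dj X))))
    (hnum : ∀ (F : T4Family) (θ : Stage13RParams F N), θ.Provisos₁₃CoPR F N → Rg F θ → θ.Admissible F N →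
      0 < (li F θ).C₀ ∧ 0 < (li F θ).θ₅ ∧ (li F θ).θ₅ < 1 ∧ 0 ≤ (li F θ).C₅ ∧ 2 * (li F θ).C₅ / (1 - (li F θ).θ₅) ≤ (li F θ).C₀ ∧ 0 < (li F θ).A ∧
        (li F θ).θ₅ ≤ (li F θ).μ ∧ (li F θ).C₀ ≤ 2 * (li F θ).A ∧ 0 < (li F θ).r ∧ 0 < (li F θ).s ∧ (li F θ).s < 1)
    (hD4 : ∀ (F : T4Family) (θ : Stage13RParams F N) (hP : θ.Provisos₁₃CoPR F N), Rg F θ → θ.Admissible F N → ∀ k : ℕ,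
      ReadOutAt (datumOfRecord₁₃CoPR F N θ hP) (u3OfRecord₁₃ θ.toStage13Params
        ((ReadingData.ofRecordAdm F θ.τ9.M N (runTowers fun k => toClusterTower (G F θ k))
          (fun (k j : ℕ) (_ : (domSys (F.P k) θ.τ9.M j).Dom) => ofBackgroundC (ιSU N) '' {V : GaugeField (F.P k) 0 (Node00.SU N) | PlaqSmall (a F θ.toStage12Params k) V})
          (gauge F θ) (hg F θ) (fun k => transportRaw F k (avOfRecord F N (k + 1) 0)) (admTransport_plaqSmall_sharp a ha hstep hguard F θ.toStage12Params) (li F θ)).u3Objects θ.γ) k))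
    (h20 : S_N20 (SRec₁₃CoPROn cr Rg)) (h21 : S_N21 (SRec₁₃CoPROn cr Rg))
    (hx : ∀ (F : T4Family) (θ : Stage13RParams F N) (hP : θ.Provisos₁₃CoPR F N), Rg F θ → θ.Admissible F N →
      B16.EndStatementBPrinted (datumOfRecord₁₃CoPR F N θ hP).C → DagBinding.EndpointExistence (datumOfRecord₁₃CoPR F N θ hP).C.toB12 →
        ForSmallCouplings (datumOfRecord₁₃CoPR F N θ hP) fun g₀ => ∀ os : List (ULoop F),
          0 < (cr F θ hP g₀ os).l₀ ∧ 0 < (cr F θ hP g₀ os).vol ∧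
          (∀ (K : ℕ) (t : ℝ), |t| ≤ (cr F θ hP g₀ os).l₀ →
            T4GenFunBounds.schemeZ ((datumOfRecord₁₃CoPR F N θ hP).scheme g₀) os ((cr F θ hP g₀ os).K₀ + K) t =
              ∑ τ ∈ (cr F θ hP g₀ os).T K, (cr F θ hP g₀ os).A K t τ) ∧
          (∀ (K : ℕ) (t : ℝ), |t| ≤ (cr F θ hP g₀ os).l₀ →
            T4GenFunBounds.schemeZ ((datumOfRecord₁₃CoPR F N θ hP).scheme g₀) os ((cr F θ hP g₀ os).K₀ + K + 1) t =
              ∑ τ ∈ (cr F θ hP g₀ os).T K, (cr F θ hP g₀ os).B K t τ))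
    (h19 : ∀ (F : T4Family) (θ : Stage13RParams F N) (hP : θ.Provisos₁₃CoPR F N), Rg F θ → θ.Admissible F N → ∀ (g₀ : ℕ → ℝ) (os : List (ULoop F)),
      (∀ k : ℕ, RatesAt (datumOfRecord₁₃CoPR F N θ hP) (rateCarriersOfRecord₁₃CoPR (readingOfRecord₁₃CoPR
        (fun F θ => ReadingData.ofRecordAdm F θ.τ9.M N (runTowers fun k => toClusterTower (G F θ k))
          (fun (k j : ℕ) (_ : (domSys (F.P k) θ.τ9.M j).Dom) => ofBackgroundC (ιSU N) '' {V : GaugeField (F.P k) 0 (Node00.SU N) | PlaqSmall (a F θ.toStage12Params k) V})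
          (gauge F θ) (hg F θ) (fun k => transportRaw F k (avOfRecord F N (k + 1) 0)) (admTransport_plaqSmall_sharp a ha hstep hguard F θ.toStage12Params) (li F θ)) ℓ₃ ne2 ne1)
          F θ hP g₀ os k)) →
        letI := (cr F θ hP g₀ os).dec
        ∃ δ : ℕ → ℝ, NE7.Core (cr F θ hP g₀ os).l₀ (cr F θ hP g₀ os).vol (cr F θ hP g₀ os).T (cr F θ hP g₀ os).Bad
          (fun K t τ => (cr F θ hP g₀ os).A K t τ - (cr F θ hP g₀ os).shA K t τ) (fun K t τ => (cr F θ hP g₀ os).B K t τ - (cr F θ hP g₀ os).shB K t τ) δ ∧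
          Summable δ) :
    Spine (N := N) fun F D w => Node00.IsRecordOfRecord₁₃CCoPROn F N Rg D w :=
  have h18' : S_N18 (RRec₁₃CoPROn (readingOfRecord₁₃CoPR (fun F θ => ReadingData.ofRecordAdm F θ.τ9.M N (runTowers fun k => toClusterTower (G F θ k))
          (fun (k j : ℕ) (_ : (domSys (F.P k) θ.τ9.M j).Dom) => ofBackgroundC (ιSU N) '' {V : GaugeField (F.P k) 0 (Node00.SU N) | PlaqSmall (a F θ.toStage12Params k) V})
          (gauge F θ) (hg F θ) (fun k => transportRaw F k (avOfRecord F N (k + 1) 0)) (admTransport_plaqSmall_sharp a ha hstep hguard F θ.toStage12Params) (li F θ)) ℓ₃ ne2 ne1) Rg) :=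
    (s_N18_readingOfRecord₁₃CoPROn_iff _ ℓ₃ ne2 ne1 Rg).mpr fun F θ hP hRg hθ k =>
      (n18At_u3OfRecord₁₃_readingAdm_iff θ.toStage13Params k (runTowers fun k => toClusterTower (G F θ k))
        (fun (k j : ℕ) (_ : (domSys (F.P k) θ.τ9.M j).Dom) => ofBackgroundC (ιSU N) '' {V : GaugeField (F.P k) 0 (Node00.SU N) | PlaqSmall (a F θ.toStage12Params k) V})
        (gauge F θ) (hg F θ) (fun k => transportRaw F k (avOfRecord F N (k + 1) 0)) (admTransport_plaqSmall_sharp a ha hstep hguard F θ.toStage12Params) (li F θ)).mpr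
        fun b hb hbγ g hgW U X => h18 F θ hP hRg hθ k b hb hbγ g hgW U.1
          ((mem_image_ofBackgroundC_iff _ U.1).1 (U.2 0 (cubeDom (F.P (k + 1)) θ.τ9.M 0 fun _ => 0))) X
  spine_rec13CCoPROn_at_readingOfRecord₁₃CoPR cr _ ℓ₃ ne2 ne1 Rg
    ((s_N14_rRec₁₃CoPROn_iff _ Rg).mpr fun F θ hP hRg hθ g₀ os => h14 F θ hP hRg hθ g₀ os)
    ((s_N15_rRec₁₃CoPROn_iff _ Rg).mpr fun F θ hP hRg hθ g₀ os k => h15 F θ hP hRg hθ g₀ os k)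
    (s_N16_rRec₁₃CoPROn_ofRecord_of_leafSlot (readingOfRecord₁₃CoPR _ ℓ₃ ne2 ne1) Rg ℓ₃ (fun _ _ _ _ _ _ => rfl) h16) h18'
    (s_N22_readingOfRecord₁₃CoPROn_gen_of_s_N18_schemasBelow G
      (fun F θ (k j : ℕ) (_ : (domSys (F.P k) θ.τ9.M j).Dom) => ofBackgroundC (ιSU N) '' {V : GaugeField (F.P k) 0 (Node00.SU N) | PlaqSmall (a F θ.toStage12Params k) V})
      gauge hg (fun F _ k => transportRaw F k (avOfRecord F N (k + 1) 0))
      (fun F θ => admTransport_plaqSmall_sharp a ha hstep hguard F θ.toStage12Params) li ne1 ℓ₃ ne2 Rg h18' hsch hnum)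
    ((s_D4_rRec₁₃CoPROn_iff _ Rg).mpr fun F θ hP hRg hθ _ _ k => hD4 F θ hP hRg hθ k) h20 h21 hx h19

end Regime

end Summit.QuantumFields.YangMills.Theorems.BalabanUVNodesN27SpineRecord

end
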